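import Summits.CriticalPhenomena.PercolationContinuityZ3.Theorems.PercNearOneGluingNoHeavyPcintNawChainMemSound
import HarnessLib

/-!
# PCINT lane, reduction B2c on the dangerous-set automaton — glue, lattice symmetry, table certificates

Cell `prim-pcint` (PAPER-2 track (iii)), seat `prim-pcint-1` (gen 5); support file (`--supports stmt-CriticalPhenomena-4575`).
Does NOT build on p205010.  Memo: run/shared/lean/prim/pcint/REDUCTIONS.md §B2c (prim-pcint-2 gen 3), §B2c.7 (reduced states).

`le_siteCriticalProb_zd_of_chainMem_total` (geometric totals ⇒ `p ≤ p_c^site(ℤ^d)`); invariance of the chain data under the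
hyperoctahedral group (`cactive_smul`, `cuncond_smul`, `cbonus_smul`, `ccorner_smul`, `cu_smul`, `cc_smul`, `cwt_smul`,
`total_chainMemAut_smul`); table certificates modulo symmetry for the chain automaton (`ctableAut`, `total_ctableAut_eq`,
`total_chainMemAut_le_of_table`, `le_siteCriticalProb_zd_of_chainMemTable`), reusing `simRel` of `…PcintNawRandMemSym`.
-/

noncomputable section

namespace Summit.CriticalPhenomena.PercolationContinuityZ3.Theorems.Pcint

open Finset Literature.Probability.Percolation Literature.Probability.LatticeModels
open Literature.Probability.FitznerVanDerHofstad2017 (wordPos_wordInit)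

variable {{d : ℕ}}

/-! ### The glue: geometric totals give a lower bound on `p_c^site(ℤ^d)` -/

section Glue

variable {τ kc : ℕ}

/-- **Reduced-state B2c certificate ⇒ `p ≤ p_c^site(ℤ^d)`** (totals of `chainMemAut` from `∅` geometrically small, `q^{2d} ≥ 1-p`).
[folklore] -/
theorem le_siteCriticalProb_zd_of_chainMem_total [NeZero d] (hτ : 2 ≤ τ) (p : unitInterval) {q C r : ℝ} (hq0 : 0 ≤ q)
    (hq1 : q ≤ 1) (hpq : 1 - (p : ℝ) ≤ q ^ (2 * d)) (hr0 : 0 ≤ r) (hr : r < 1)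
    (htot : ∀ n, (chainMemAut τ kc p q p.2.1 hq0).total n (∅ : MState d) ≤ C * r ^ n) :
    (p : ℝ) ≤ siteCriticalProb (zdGraph d) 0 := by
  have a₀ : Fin d × Bool := (⟨0, NeZero.pos d⟩, true)
  have ht : Filter.Tendsto (fun n : ℕ => (p : ℝ) * C * r ^ n) Filter.atTop (nhds 0) := by
    simpa using (tendsto_pow_atTop_nhds_zero_of_lt_one hr0 hr).const_mul ((p : ℝ) * C)
  have h0 : siteTheta (zdGraph d) 0 p = 0 := by
    refine le_antisymm (ge_of_tendsto' ht fun n => ?_) MeasureTheory.measureReal_nonneg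
    calc siteTheta (zdGraph d) 0 p ≤ (p : ℝ) * (chainMemAut τ kc p q p.2.1 hq0).total n (∅ : MState d) :=
          siteTheta_le_chainMem_total a₀ hτ p hq0 hq1 hpq n
      _ ≤ (p : ℝ) * (C * r ^ n) := mul_le_mul_of_nonneg_left (htot n) p.2.1
      _ = (p : ℝ) * C * r ^ n := by ring
  refine le_csInf ⟨1, Or.inr rfl⟩ ?_
  rintro r' (⟨hr', hθ⟩ | hr')
  · by_contra hlt
    push Not at hlt
    have hmono := siteTheta_mono (G := zdGraph d) (0 : Site d) (show (⟨r', hr'⟩ : unitInterval) ≤ p from hlt.le)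
    exact hθ.not_ge (hmono.trans_eq h0)
  · rw [Set.mem_singleton_iff] at hr'
    rw [hr']
    exact p.2.2

end Glue

/-! ### Lattice symmetry: the chain rule is equivariant, totals are invariant -/

section ChainSymmetry

variable (τ kc : ℕ)

/-- The neighbour vector is equivariant. [folklore] -/
theorem cnbr_smul (g : SPerm d) (a b : Fin d × Bool) : cnbr (smulLetter g a) (smulLetter g b) = smulSite g (cnbr a b) := by
  rw [cnbr, cnbr, stepVec_smulLetter, stepVec_smulLetter, smulSite_add]

/-- Visible incidences are equivariant. [folklore] -/
theorem mem_cvis_smul (g : SPerm d) (S : MState d) (a b : Fin d × Bool) (q : Site d × ℕ) :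
    q ∈ cvis (smulState g S) (smulLetter g a) (smulLetter g b) ↔ ∃ r, (r, q.2) ∈ cvis S a b ∧ q.1 = smulSite g r := by
  rw [mem_cvis, mem_smulState, cnbr_smul]
  constructor
  · rintro ⟨⟨r, hr, hq⟩, hadj⟩
    refine ⟨r, mem_cvis.2 ⟨hr, ?_⟩, hq⟩
    rw [hq] at hadj; exact (adj_smulSite_iff g _ _).1 hadj
  · rintro ⟨r, hr, hq⟩
    obtain ⟨hrS, hadj⟩ := mem_cvis.1 hr
    exact ⟨⟨r, hrS, hq⟩, by rw [hq]; exact (adj_smulSite_iff g _ _).2 hadj⟩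

/-- A property of ages of visible incidences transfers along the symmetry (existential form). [folklore] -/
theorem exists_cvis_smul_iff (g : SPerm d) (S : MState d) (a b : Fin d × Bool) (P : ℕ → Prop) :
    (∃ q ∈ cvis (smulState g S) (smulLetter g a) (smulLetter g b), P q.2) ↔ ∃ q ∈ cvis S a b, P q.2 := by
  constructor
  · rintro ⟨q, hq, hP⟩
    obtain ⟨r, hr, -⟩ := (mem_cvis_smul g S a b q).1 hq
    exact ⟨(r, q.2), hr, hP⟩
  · rintro ⟨q, hq, hP⟩
    exact ⟨(smulSite g q.1, q.2), (mem_cvis_smul g S a b _).2 ⟨q.1, by simpa using hq, rfl⟩, hP⟩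

/-- A property of ages of visible incidences transfers along the symmetry (universal form). [folklore] -/
theorem forall_cvis_smul_iff (g : SPerm d) (S : MState d) (a b : Fin d × Bool) (P : ℕ → Prop) :
    (∀ q ∈ cvis (smulState g S) (smulLetter g a) (smulLetter g b), P q.2) ↔ ∀ q ∈ cvis S a b, P q.2 := by
  constructor
  · intro h q hq
    exact h (smulSite g q.1, q.2) ((mem_cvis_smul g S a b _).2 ⟨q.1, by simpa using hq, rfl⟩)
  · intro h q hq
    obtain ⟨r, hr, -⟩ := (mem_cvis_smul g S a b q).1 hq
    exact h (r, q.2) hr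

/-- `cactive` is invariant. [folklore] -/
theorem cactive_smul (g : SPerm d) (S : MState d) (a b : Fin d × Bool) :
    cactive kc (smulState g S) (smulLetter g a) (smulLetter g b) = cactive kc S a b := by
  rw [Bool.eq_iff_iff, cactive_iff, cactive_iff, cnbr_smul, exists_cvis_smul_iff g S a b (fun j => j + 1 ≤ kc)]
  have h0 : smulSite g (cnbr a b) ≠ 0 ↔ cnbr a b ≠ 0 := by
    rw [not_iff_not]
    constructor
    · intro h; apply smulSite_injective g; rw [h]; ext i; simp [smulSite]
    · intro h; rw [h]; ext i; simp [smulSite]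
  rw [h0]

/-- `cuncond` is invariant. [folklore] -/
theorem cuncond_smul (g : SPerm d) (S : MState d) (a b : Fin d × Bool) :
    cuncond (smulState g S) (smulLetter g a) (smulLetter g b) = cuncond S a b := by
  rw [Bool.eq_iff_iff, cuncond_iff, cuncond_iff]
  exact exists_cvis_smul_iff g S a b (fun j => 3 ≤ j)

/-- `cbonus` is invariant. [folklore] -/
theorem cbonus_smul (g : SPerm d) (S : MState d) (a b : Fin d × Bool) :
    cbonus τ kc (smulState g S) (smulLetter g a) (smulLetter g b) = cbonus τ kc S a b := by
  rw [Bool.eq_iff_iff, cbonus_iff, cbonus_iff]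
  have key : ∀ (T : MState d) (a' b' : Fin d × Bool) (q₁ : Site d × ℕ), bonusWit τ kc T a' b' q₁ = true ↔
      q₁ ∈ cvis T a' b' ∧ (∃ q ∈ cvis T a' b', q.2 = q₁.2 ∧ q₁.2 + kc + 3 ≤ τ) ∧
        ∀ q ∈ cvis T a' b', q.2 = q₁.2 ∨ q₁.2 + kc < q.2 := by
    intro T a' b' q₁
    rw [bonusWit_iff]
    constructor
    · rintro ⟨h1, h2, h3⟩; exact ⟨h1, ⟨q₁, h1, rfl, h2⟩, h3⟩
    · rintro ⟨h1, ⟨-, -, -, h2⟩, h3⟩; exact ⟨h1, h2, h3⟩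
  constructor
  · rintro ⟨q₁, hq₁⟩
    obtain ⟨h1, h2, h3⟩ := (key _ _ _ q₁).1 hq₁
    obtain ⟨r, hr, -⟩ := (mem_cvis_smul g S a b q₁).1 h1
    refine ⟨(r, q₁.2), (key _ _ _ _).2 ⟨hr, ?_, ?_⟩⟩
    · exact (exists_cvis_smul_iff g S a b (fun j => j = q₁.2 ∧ q₁.2 + kc + 3 ≤ τ)).1 h2
    · exact (forall_cvis_smul_iff g S a b (fun j => j = q₁.2 ∨ q₁.2 + kc < j)).1 h3
  · rintro ⟨q₁, hq₁⟩
    obtain ⟨h1, h2, h3⟩ := (key _ _ _ q₁).1 hq₁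
    refine ⟨(smulSite g q₁.1, q₁.2), (key _ _ _ _).2 ⟨(mem_cvis_smul g S a b _).2 ⟨q₁.1, by simpa using h1, rfl⟩, ?_, ?_⟩⟩
    · exact (exists_cvis_smul_iff g S a b (fun j => j = q₁.2 ∧ q₁.2 + kc + 3 ≤ τ)).2 h2
    · exact (forall_cvis_smul_iff g S a b (fun j => j = q₁.2 ∨ q₁.2 + kc < j)).2 h3

/-- `ccorner` is invariant. [folklore] -/
theorem ccorner_smul (g : SPerm d) (S : MState d) (b : Fin d × Bool) :
    ccorner (smulState g S) (smulLetter g b) = ccorner S b := by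
  rw [Bool.eq_iff_iff, ccorner_iff, ccorner_iff, stepVec_smulLetter, mem_smulState]
  constructor
  · rintro ⟨r, hr, h⟩; rwa [smulSite_injective g h]
  · intro h; exact ⟨stepVec b, h, rfl⟩

/-- `cpay` is invariant. [folklore] -/
theorem cpay_smul (g : SPerm d) (S : MState d) (a b : Fin d × Bool) :
    cpay τ kc (smulState g S) (smulLetter g a) (smulLetter g b) = cpay τ kc S a b := by
  unfold cpay; rw [cactive_smul kc, cbonus_smul τ kc]

/-- `cu` is invariant. [folklore] -/
theorem cu_smul (g : SPerm d) (S : MState d) (a : Fin d × Bool) : cu τ kc (smulState g S) (smulLetter g a) = cu τ kc S a := by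
  unfold cu
  rw [← Equiv.sum_comp (letterEquiv g)]
  refine sum_congr rfl fun b _ => ?_
  rw [show letterEquiv g b = smulLetter g b from rfl, cuncond_smul, cpay_smul τ kc]

/-- `cc` is invariant. [folklore] -/
theorem cc_smul (g : SPerm d) (S : MState d) (a : Fin d × Bool) : cc τ kc (smulState g S) (smulLetter g a) = cc τ kc S a := by
  unfold cc
  rw [← Equiv.sum_comp (letterEquiv g)]
  refine sum_congr rfl fun b _ => ?_
  rw [show letterEquiv g b = smulLetter g b from rfl, cuncond_smul, ccorner_smul, cpay_smul τ kc]

/-- The step factor is invariant. [folklore] -/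
theorem cwt_smul (q : ℝ) (g : SPerm d) (S : MState d) (a : Fin d × Bool) :
    cwt τ kc q (smulState g S) (smulLetter g a) = cwt τ kc q S a := by
  unfold cwt; rw [cu_smul τ kc, cc_smul τ kc]

variable {τ kc}

/-- Row sums of `chainMemAut` against an invariant function are invariant. [folklore] -/
theorem stepSum_chainMemAut_smul {p q : ℝ} (hp : 0 ≤ p) (hq : 0 ≤ q) (g : SPerm d) {f : MState d → ℝ}
    (hf : ∀ T, f (smulState g T) = f T) (S : MState d) :
    (chainMemAut τ kc p q hp hq).stepSum f (smulState g S) = (chainMemAut τ kc p q hp hq).stepSum f S := by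
  unfold WAut.stepSum
  rw [← Equiv.sum_comp (letterEquiv g)]
  refine Finset.sum_congr rfl fun a _ => ?_
  have h1 : (chainMemAut τ kc p q hp hq).step (smulState g S) (letterEquiv g a) =
      ((chainMemAut τ kc p q hp hq).step S a).map (smulState g) := nstep_smul τ g S a
  have h2 : (chainMemAut τ kc p q hp hq).wt (smulState g S) (letterEquiv g a) = (chainMemAut τ kc p q hp hq).wt S a := by
    show p * cwt τ kc q (smulState g S) (smulLetter g a) = p * cwt τ kc q S a
    rw [cwt_smul]
  rw [h1, h2]
  cases (chainMemAut τ kc p q hp hq).step S a with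
  | none => rfl
  | some T => simp only [Option.map_some, hf]

/-- **Totals of the B2c automaton are invariant under lattice symmetries.** [folklore] -/
theorem total_chainMemAut_smul {p q : ℝ} (hp : 0 ≤ p) (hq : 0 ≤ q) (g : SPerm d) :
    ∀ (n : ℕ) (S : MState d), (chainMemAut τ kc p q hp hq).total n (smulState g S) = (chainMemAut τ kc p q hp hq).total n S := by
  intro n
  induction n with
  | zero => intro S; rw [WAut.total_zero, WAut.total_zero]
  | succ n ih =>
    intro S
    rw [WAut.total_succ, WAut.total_succ]
    exact stepSum_chainMemAut_smul hp hq g (fun T => ih T) S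

end ChainSymmetry

/-! ### Table certificates for the chain automaton -/

section ChainTable

variable {τ kc N : ℕ}

/-- The index automaton of a table, with the chain weights recomputed from the rows' states. [folklore] -/
def ctableAut (τ kc : ℕ) (p q : ℝ) (hp : 0 ≤ p) (hq : 0 ≤ q) (R : Fin N → MState d)
    (sc : Fin N → Fin d × Bool → Option (Fin N × SPerm d)) : WAut (Fin N) (Fin d × Bool) where
  step i a := (sc i a).map Prod.fst
  wt i a := (chainMemAut τ kc p q hp hq).wt (R i) a
  wt_nonneg i a := (chainMemAut τ kc p q hp hq).wt_nonneg (R i) a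

/-- **Simulation** for the chain automaton. [folklore] -/
theorem total_ctableAut_eq {p q : ℝ} (hp : 0 ≤ p) (hq : 0 ≤ q) (R : Fin N → MState d)
    (sc : Fin N → Fin d × Bool → Option (Fin N × SPerm d)) (hsim : ∀ i a, simRel R (nstep τ (R i) a) (sc i a) = true) :
    ∀ (n : ℕ) (i : Fin N), (ctableAut τ kc p q hp hq R sc).total n i = (chainMemAut τ kc p q hp hq).total n (R i) := by
  intro n
  induction n with
  | zero => intro i; rw [WAut.total_zero, WAut.total_zero]
  | succ n ih =>
    intro i
    rw [WAut.total_succ, WAut.total_succ]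
    unfold WAut.stepSum
    refine Finset.sum_congr rfl fun a _ => ?_
    have h := hsim i a
    have e1 : (ctableAut τ kc p q hp hq R sc).step i a = (sc i a).map Prod.fst := rfl
    have e2 : (chainMemAut τ kc p q hp hq).step (R i) a = nstep τ (R i) a := rfl
    rw [e1, e2]
    revert h
    generalize nstep τ (R i) a = oT
    generalize sc i a = oJ
    intro h
    cases oT with
    | none =>
      cases oJ with
      | none => rfl
      | some jg => exact absurd h (by simp [simRel])
    | some T =>
      cases oJ with
      | none => exact absurd h (by simp [simRel])
      | some jg =>
        have hT : T = smulState jg.2 (R jg.1) := by simpa [simRel] using h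
        simp only [Option.map_some]
        rw [ih jg.1, hT, total_chainMemAut_smul]
        rfl

/-- **Table certificate ⇒ geometric bound on the totals of `chainMemAut`.** [folklore] -/
theorem total_chainMemAut_le_of_table {p q lam : ℝ} (hp : 0 ≤ p) (hq : 0 ≤ q) (hlam : 0 ≤ lam) (R : Fin N → MState d)
    (sc : Fin N → Fin d × Bool → Option (Fin N × SPerm d)) (V : Fin N → ℝ) (hV : ∀ i, 1 ≤ V i)
    (hsim : ∀ i a, simRel R (nstep τ (R i) a) (sc i a) = true)
    (hcw : ∀ i, (∑ a : Fin d × Bool, match sc i a with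
      | none => 0
      | some jg => p * cwt τ kc q (R i) a * V jg.1) ≤ lam * V i) (n : ℕ) (i : Fin N) :
    (chainMemAut τ kc p q hp hq).total n (R i) ≤ lam ^ n * V i := by
  rw [← total_ctableAut_eq hp hq R sc hsim n i]
  have hcw' : ∀ i, (ctableAut τ kc p q hp hq R sc).stepSum V i ≤ lam * V i := fun i => by
    refine le_of_eq_of_le ?_ (hcw i)
    unfold WAut.stepSum
    refine Finset.sum_congr rfl fun a _ => ?_
    have e1 : (ctableAut τ kc p q hp hq R sc).step i a = (sc i a).map Prod.fst := rfl
    rw [e1]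
    cases sc i a with
    | none => rfl
    | some jg => rfl
  have := (ctableAut τ kc p q hp hq R sc).total_le_of_cw one_pos hV hlam hcw' n i
  rwa [div_one] at this

/-- **Reduced-state B2c certificate (table form) ⇒ `p ≤ p_c^site(ℤ^d)`.** [folklore] -/
theorem le_siteCriticalProb_zd_of_chainMemTable [NeZero d] (hτ : 2 ≤ τ) (p : unitInterval) {q lam : ℝ} (hq0 : 0 ≤ q)
    (hq1 : q ≤ 1) (hpq : 1 - (p : ℝ) ≤ q ^ (2 * d)) (hlam0 : 0 ≤ lam) (hlam1 : lam < 1)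
    (R : Fin N → MState d) (sc : Fin N → Fin d × Bool → Option (Fin N × SPerm d)) (V : Fin N → ℝ)
    (i₀ : Fin N) (h0 : R i₀ = ∅) (hV : ∀ i, 1 ≤ V i) (hsim : ∀ i a, simRel R (nstep τ (R i) a) (sc i a) = true)
    (hcw : ∀ i, (∑ a : Fin d × Bool, match sc i a with
      | none => 0
      | some jg => (p : ℝ) * cwt τ kc q (R i) a * V jg.1) ≤ lam * V i) :
    (p : ℝ) ≤ siteCriticalProb (zdGraph d) 0 := by
  refine le_siteCriticalProb_zd_of_chainMem_total (kc := kc) hτ p hq0 hq1 hpq hlam0 hlam1 (C := V i₀) fun n => ?_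
  have h := total_chainMemAut_le_of_table p.2.1 hq0 hlam0 R sc V hV hsim hcw n i₀
  rw [h0] at h
  exact h.trans_eq (mul_comm _ _)

end ChainTable

end Summit.CriticalPhenomena.PercolationContinuityZ3.Theorems.Pcint
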